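import Summits.QuantumFields.BalabanUV.Beta.WardLocusCombShift
import Summits.QuantumFields.BalabanUV.Beta.SymSecondOrderTablesAn1
import Summits.QuantumFields.BalabanUV.Beta.SymAveragingWardRootedStencils

/-!
# `BalabanUV.Beta.CombFormSlotGaugeLetter` — binder row D1, the DICTIONARY's answer to road «FP»'s Q-FP-19-1 ≡ Q-d1leaf02-g20-1, IN THE KERNEL:
# **THE FIRST-ORDER FORM SLOT OF THE CHART-(III′) LITERAL OBEYS THE PER-SITE GAUGE LETTER WITH CONSTANT `½` AT EVERY LEVEL, AND ITS WEIGHT RELATIVE TO THE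
# BORDER SLOT IS `−2·c_j·wVH_j`, `c_j = (stepScale_j·Lc^{d+1})⁻¹` — at level `0`: `w₀ = cE∕cVH = −2·Lc^{−(d+1)} = −2c₀`**

WHY (road «FP», route T, (T-β-1); journal Q-d1leaf02-g20-1 l.42277 ∕ Q-FP-19-1 l.42389 ∕ [D1P3-G19-INBOX-1]; leaf-05 g27 `FP/PeriodisedFormIndexWard` header: «levels
`j ≥ 1` — the form block `wVH·E2` … — are the dictionary's ∕ the OWNER's»).  The graded torus door has ONE field-transport generator `X` serving the form row `k1`
and the averaging rows `q1 j1`; leaf-02's `q1` pins `X = −c_j • E_λ` (`FP/NestedStepLawTorusTransportedRows` `hX`, `c_j = (Lc^{d+1}·stepScale d Lc j)⁻¹`), leaf-05's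
`torus_k1_sim_letter` then forces the form family's weight `w = −2c` GIVEN the level-0 gauge constant `½` of the UNWEIGHTED Wilson table (`torus_H1_gauge_shift`,
from `WilsonDivergenceContact.divV_wilsonA_inl_inl`).  The question to the dictionary: does the literal of the repair track carry that weight, and what is the letter
at `j ≥ 1`?  ANSWER (this file, [folklore] over OUR typed objects, BY NAME):
(1) §1 **`divV_e3OfK_SrecOf_GcombSh`** (generic `d`, the pins `(cE, cVH) = (Lc^{d+1}, −Lc^{d+1}·½·Lc^{d+1})`, under an1's border Ward letter (V-d)): for EVERY level
    `j`, every fine site `u` of the level-`(j+1)` lattice and every root `ρ′`, the UNWEIGHTED level-`(j+1)` form table `T_{j+1} := e3OfK Lc (G′_j) (SrecOf … j)` (the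
    cubic sector of the literal's member `j+1`, `G′_j = GcombSh Lc j`) obeys the PER-SITE gauge letter
    `divV T_{j+1} u = ½ • conjV (E2 d Lc (j+1)) (diagK (legInd ρ′ u))` — the level-`(j+1)` twin of leaf-05's level-0 law, SAME constant `½` at every level, against
    the level-`(j+1)` form block `E2 (j+1) = mmRead Lc G′_j` (`CombChartContactFactor.mmRead_GcombSh`).  It is `WardLocusCubic.divV_e3K_eq_conjV` (an2 gen 14's
    cubic Ward socket) at the (III′) data, every socket a THEOREM of the chain: (Sd) at level `j` = `WardLocusCombShift.hSd_SrecOf_GcombSh_bhKStepSh_all_pins`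
    (generator `½ • 𝟙_{B(y)}`, prefactor `c_j`), ℋ-column Ward `CombChartHColumnWard.colH_ward_GcombSh` (constant `c_j`), P2 `RelInvCombShiftedSpread.relInv_coDressKAt_Gsym_bhKStepSh`,
    diagonal commutation `comp_axEc_diagK_comm`, `loc_diagK_smul_sum_legInd`, `locStencil_SrecOf`, `decays_GcombSh`.
(2) §2 THE UNITS IDENTITIES (arithmetic on the tree's numerals `wE = stepScale³`, `wVH = stepScale²`): with `a_j := cE·wE_j` (form-slot weight), `b_j := cVH·wVH_j`
    (border-slot weight), `c_j := (stepScale_j·Lc^{d+1})⁻¹` (leaf-02's transport weight = the chain's `cH j`): **`a_j = (−2·c_j·wVH_j)·b_j`** (`formWeight_eq`) — so in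
    the road's currency (border insertion at weight `1`, `X = −c_j • E_λ`, form BLOCK `wVH_j • E2_j` per `bhKStepAt`) the literal's form family enters at weight
    `w_j = −2·c_j·wVH_j`, i.e. **`w₀ = −2c₀`** at level `0` (`formWeight_zero`: `cE = (−2c₀)·cVH`), and the reflection-contact generator weight of the (Sr-conj) letters is
    **`γ_j = c_j·b_j`** (`genWeight_eq`: the displayed `γ_j = −(Lc⁸∕2)·wVH_j∕(stepScale_j·Lc⁴)` of `CombLevelZeroT2Law` ∕ `CombSecondOrderRemainderAn1` IS transport weight ×
    border weight — the MODULUS of identification (b) at every level; the generators themselves — axis-REFLECTION contact `ctGenM` vs GAUGE transport `E_λ` — are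
    different letters and are NOT identified).
(2b) ENTRYWISE on the field–field block (`…_inl_inl`, §1 and §3): `(divV T_{j+1} u) x z (inl a) (inl b) = ½·E2 (j+1) x z (inl a) (inl b)·([z = u] − [x = u])` —
    leaf-05's `divV_wilsonA_inl_inl` shape one level up, the input of the torus periodisation.
(3) §3 `d + 1 = 4`: the literal's member `j+1` displayed (`JsB12CombSh0_S_succ`: cubic sector `Lc⁴·wE (j+1)` through `e3OfK Lc (GcombSh Lc j)`, border `−Lc⁸∕2·wVH (j+1)`,
    Λ-sector `cΛ·wΛ (j+1)`), **`divV_formSlot_JsB12CombSh0`** (§1 for `JsB12CombSh0 hLc N tabs cΛ cB` under (S-V)⁰⁴ of `tabs.V`, via `DshAn1.hVd_iff`) and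
    **`divV_formSlot_JsB12CombSh0_an1TablesS2`** — UNCONDITIONAL at an1's closed record `symTablesAn1S2 3 Lc cΛ` ((S-V)⁰⁴ = an1's `divV_symVhSAt_eq_conjV_ctr`): the
    form slot of the literal OF THE ROOT OF RECORD's chain (M″∕M‴) obeys the per-site gauge letter with constant `½` at every level `j+1 ≥ 1`.
WHAT THIS GIVES ROAD «FP»: the STENCIL form (infinite lattice, per fine site) of the door's `k1` row at every level `j ≥ 1`, BY NAME, with the constant and the weights
displayed; its periodisation to the torus rows (leaf-02's `PeriodisedBorderIndexWard.sum_tgrad_mul_perZ_dper_of_indexLaw`) and the matrix currency are the road's ∕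
the leaves' step, exactly as leaf-05 did at level `0` from `divV_wilsonA_inl_inl`.  Level `0` itself is leaf-05's `torus_H1_gauge_shift` (the form slot there is `wilsonA`).
WHAT THIS IS NOT: not a statement about Bałaban's papers; not the torus `k1` row; not `D1Tel`; the numerals `cE, cVH, wE, wVH` are the tree's PROVISIONAL pins (their
citation-fit is REFEREE #86 item 4 (a), not touched); NOT D1, NOT `BetaPertH`, NOT continuum, NOT Clay.
HONEST FRAMING (cell contract, verbatim): «discharging `BetaPertH` makes Bałaban's UV stability UNCONDITIONAL — a real constructive-QFT
result; it is NOT the continuum limit and NOT the Clay problem.»  HONEST DEPENDENCY: continuum YM on T⁴ ⇐ BetaPertH ∧ nine spine estimates (0/9 proved);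
BetaPertH ⇐ (D1) ∧ (D4) ∧ CAP+tail; G-an2-4 gates asym, D1 and NE2/3/4.
DERIVED cell leaf ([folklore] BY NAME; β sub-cell, BINDER-OWNERS row D1 OWNER `b2b-balaban-beta-an2` gen 39).  No statement of Bałaban's papers, no `[cite:]`, no
`Prop` fact, no `def`.  Provenance: β sub-cell, unit beta-an2 gen 39, 2026-08-22 (v1); over `WardLocusCubic` (gen 14), `WardLocusCombShift` ∕ `CombChartHColumnWard` ∕
`CombChartContactFactor` (gen 36), `RelInvCombShiftedSpread` ∕ `CombChartStepJets` (gen 35), an1's `SymAveragingWardRootedStencils` ∕ `SymSecondOrderTablesAn1`, leaf-03's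
`DiagonalContact` BY NAME; no existing file touched.
-/

noncomputable section

open Finset
open scoped BigOperators
open Literature.MathematicalPhysics.QuantumFieldTheory
open Literature.MathematicalPhysics.QuantumFieldTheory.Balaban1983to89
open Literature.MathematicalPhysics.QuantumFieldTheory.Balaban1983to89.Beta
open ExpKernelCalculus (MKer Decays comp VertexFamily)
open OneStepResolventKernel (Fib LocStencil KInv)
open OneStepKernelFamily (KInvStep)
open KernelWard (divV)
open StepJetData (mfNeg wilsonA)
open AffineAveraging (box toSite)
open AveragingContoursRooted (ctr ctrOff ctrOff_mem_box)
open BalabanStepJets (lamCoeffOf)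
open BalabanStepJetsSucc (mmRead wE wVH wΛ E2 lamCoeffK)
open InterLevelTransport (SLam)
open Summit.QuantumFields.BalabanUV.Beta.TameKernelCalculus
open Summit.QuantumFields.BalabanUV.Beta.ChartConjugation (conjV)
open Summit.QuantumFields.BalabanUV.Beta.AxialDressingRooted (one_le_of_neZero axEc spr_axEc)
open Summit.QuantumFields.BalabanUV.Beta.BorderedHessian (bhK stepScale stepScale_ne_zero diagK comp_axEc_diagK_comm conjV_diagK_apply)
open Summit.QuantumFields.BalabanUV.Beta.AveragingWardRootedStencils (legInd legInd_inl)
open Summit.QuantumFields.BalabanUV.Beta.WardLocusStencils (ffK)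
open Summit.QuantumFields.BalabanUV.Beta.WardLocusRecursive (SrecOf SrecOf_zero SrecOf_succ e3OfK_eq_e3K)
open Summit.QuantumFields.BalabanUV.Beta.SpineRooted (e3OfK S0NOf locStencil_SrecOf)
open Summit.QuantumFields.BalabanUV.Beta.WardLocusCubic (e3K divV_e3K_eq_conjV)
open Summit.QuantumFields.BalabanUV.Beta.WardLocusInduction (wVH_eq_stepScale_sq wE_eq_stepScale_cube)
open Summit.QuantumFields.BalabanUV.Beta.KernelWardLevels (loc_diagK_smul_sum_legInd)
open Summit.QuantumFields.BalabanUV.Beta.SymmetrisedStepJets (SymTables)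
open Summit.QuantumFields.BalabanUV.Beta.SymShiftedSpread (bhKStepSh spr_bhKStepSh)
open Summit.QuantumFields.BalabanUV.Beta.DshAn1 (Dsh spr_Dsh linSym04At hVd_iff)
open Summit.QuantumFields.BalabanUV.Beta.CombChartStepJets (GcombSh decays_GcombSh ScombOf ScombOf_eq JsComb0Of_S JsB12CombSh0 JsB12CombSh0_eq)
open Summit.QuantumFields.BalabanUV.Beta.RelInvCombShiftedSpread (relInv_coDressKAt_Gsym_bhKStepSh)
open Summit.QuantumFields.BalabanUV.Beta.CombChartContactFactor (mmRead_GcombSh)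
open Summit.QuantumFields.BalabanUV.Beta.CombChartHColumnWard (colH_ward_GcombSh)
open Summit.QuantumFields.BalabanUV.Beta.WardLocusCombShift (hSd_SrecOf_GcombSh_bhKStepSh_all_pins)
open Summit.QuantumFields.BalabanUV.Beta.SymSecondOrderTablesAn1 (symTablesAn1S2 symTablesAn1S2_def)
open Summit.QuantumFields.BalabanUV.Beta.SymAveragingWardRootedStencils (divV_symVhSAt_eq_conjV_ctr)

namespace Summit.QuantumFields.BalabanUV.Beta.CombFormSlotGaugeLetter

variable {d : ℕ}

/-! ## §1 The per-site gauge letter of the level-`(j+1)` form slot, constant `½`, every level (generic `d`, the pins, under (V-d)) -/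

section Generic

variable {Lc : ℕ} [NeZero Lc]

/-- [folklore] **THE LEVEL-`(j+1)` FORM SLOT OF THE CHART-(III′) RECURSION OBEYS THE PER-SITE GAUGE LETTER WITH CONSTANT `½`, AT EVERY LEVEL.**
For the slotted recursive family `SrecOf V H (GcombSh Lc)` at the pins `(cE, cVH) = (Lc^{d+1}, −Lc^{d+1}·½·Lc^{d+1})` (any `cΛ`), under (LV)(LH) and an1's border
Ward letter (V-d) of `V` against `bhK Lc + Dsh Lc`: for every level `j`, every root `ρ′` and every fine site `u`,
`divV (e3OfK Lc (GcombSh Lc j) (SrecOf … j)) u = ½ • conjV (E2 d Lc (j+1)) (diagK (legInd ρ′ u))`.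
(`WardLocusCubic.divV_e3K_eq_conjV` at the (III′) data; every socket a theorem of the chain — see the module docstring.) -/
theorem divV_e3OfK_SrecOf_GcombSh {V H : Fin (d + 1) → (Fin (d + 1) → ℤ) → MKer (d + 1) (Fib d)}
    (hV : ∀ δ : ℝ, 0 ≤ δ → ∃ C : ℝ, LocStencil V C δ) (hH : ∀ δ : ℝ, 0 ≤ δ → ∃ C : ℝ, VertexFamily H Lc C δ)
    (hVd : ∀ u : Fin (d + 1) → ℤ, conjV (bhK Lc + Dsh Lc) (diagK (legInd (ctr (d + 1) Lc) u)) =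
      conjV (ffK (bhK (d := d) Lc)) (diagK (legInd (ctr (d + 1) Lc) u)) - ((Lc : ℝ) ^ (d + 1)) • divV V u)
    (cΛ : ℝ) :
    ∀ (j : ℕ) (ρ' u : Fin (d + 1) → ℤ),
      divV (e3OfK Lc (GcombSh (d := d) Lc j)
          (SrecOf d Lc V H (GcombSh Lc) ((Lc : ℝ) ^ (d + 1)) (-((Lc : ℝ) ^ (d + 1) * (1 / 2) * (Lc : ℝ) ^ (d + 1))) cΛ j)) u =
        (1 / 2 : ℝ) • conjV (E2 d Lc (j + 1)) (diagK (legInd ρ' u)) := by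
  intro j ρ' u
  have hLc : 1 ≤ Lc := one_le_of_neZero Lc
  have hr : ctrOff (d + 1) Lc ∈ box (d + 1) Lc := ctrOff_mem_box hLc
  obtain ⟨Cs, δs, hδs, hS⟩ := locStencil_SrecOf (d := d) hLc hV hH (decays_GcombSh Lc) ((Lc : ℝ) ^ (d + 1))
    (-((Lc : ℝ) ^ (d + 1) * (1 / 2) * (Lc : ℝ) ^ (d + 1))) cΛ j
  rw [e3OfK_eq_e3K, ← mmRead_GcombSh (d := d) (Lc := Lc) j]
  exact divV_e3K_eq_conjV (decays_GcombSh Lc j) (spr_bhKStepSh (spr_Dsh hLc) j) (spr_axEc _ _)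
    (relInv_coDressKAt_Gsym_bhKStepSh (d := d) (Lc := Lc) j) hLc hS hδs hr
    ((stepScale d Lc j * (Lc : ℝ) ^ (d + 1))⁻¹) (1 / 2 : ℝ)
    (fun y κ' u => colH_ward_GcombSh (d := d) (Lc := Lc) j y κ' u) (fun y => loc_diagK_smul_sum_legInd Lc _ (1 / 2 : ℝ) y)
    (fun y => comp_axEc_diagK_comm _ _ _) (hSd_SrecOf_GcombSh_bhKStepSh_all_pins hV hH hVd cΛ j) ρ' u

/-- [folklore] **THE SAME LAW READ ON THE FIELD–FIELD BLOCK, ENTRYWISE** (the shape of leaf-05's `divV_wilsonA_inl_inl` one level up, the input of the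
periodisation step): `(divV T_{j+1} u) x z (inl a) (inl b) = ½ · E2 d Lc (j+1) x z (inl a) (inl b) · ([z = u] − [x = u])`. -/
theorem divV_e3OfK_SrecOf_GcombSh_inl_inl {V H : Fin (d + 1) → (Fin (d + 1) → ℤ) → MKer (d + 1) (Fib d)}
    (hV : ∀ δ : ℝ, 0 ≤ δ → ∃ C : ℝ, LocStencil V C δ) (hH : ∀ δ : ℝ, 0 ≤ δ → ∃ C : ℝ, VertexFamily H Lc C δ)
    (hVd : ∀ u : Fin (d + 1) → ℤ, conjV (bhK Lc + Dsh Lc) (diagK (legInd (ctr (d + 1) Lc) u)) =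
      conjV (ffK (bhK (d := d) Lc)) (diagK (legInd (ctr (d + 1) Lc) u)) - ((Lc : ℝ) ^ (d + 1)) • divV V u)
    (cΛ : ℝ) (j : ℕ) (u x z : Fin (d + 1) → ℤ) (a b : Fin (d + 1)) :
    divV (e3OfK Lc (GcombSh (d := d) Lc j)
        (SrecOf d Lc V H (GcombSh Lc) ((Lc : ℝ) ^ (d + 1)) (-((Lc : ℝ) ^ (d + 1) * (1 / 2) * (Lc : ℝ) ^ (d + 1))) cΛ j)) u x z (Sum.inl a) (Sum.inl b) =
      (1 / 2 : ℝ) * (E2 d Lc (j + 1) x z (Sum.inl a) (Sum.inl b) * ((if z = u then 1 else 0) - (if x = u then 1 else 0))) := by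
  have h := congrFun (congrFun (congrFun (congrFun (divV_e3OfK_SrecOf_GcombSh (d := d) hV hH hVd cΛ j u u) x) z) (Sum.inl a)) (Sum.inl b)
  rw [h, Pi.smul_apply, Pi.smul_apply, Pi.smul_apply, Pi.smul_apply, smul_eq_mul, conjV_diagK_apply, legInd_inl, legInd_inl]

end Generic

/-! ## §2 The units identities: form-slot weight vs border-slot weight vs transport weight, every level (arithmetic on the tree's numerals) -/

section Units

variable (d) (Lc : ℕ) [NeZero Lc]

/-- [folklore] **FORM-SLOT WEIGHT = (−2 · transport weight · form-block weight) · BORDER-SLOT WEIGHT, at every level** (generic `d`): with the pins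
`cE = Lc^{d+1}`, `cVH = −Lc^{d+1}·½·Lc^{d+1}`, the step weights `wE j`, `wVH j` and `c_j := (stepScale d Lc j · Lc^{d+1})⁻¹`:
`cE·wE j = (−2·c_j·wVH j)·(cVH·wVH j)` — in road «FP»'s currency (border insertion at weight `1`, generator `X = −c_j • E_λ`, form block `wVH j • E2 j`)
the literal's first-order form family carries the weight `w_j = −2·c_j·wVH j`. -/
theorem formWeight_eq (j : ℕ) :
    (Lc : ℝ) ^ (d + 1) * wE d Lc j =
      (-2 * ((stepScale d Lc j * (Lc : ℝ) ^ (d + 1))⁻¹ * wVH d Lc j)) * (-((Lc : ℝ) ^ (d + 1) * (1 / 2) * (Lc : ℝ) ^ (d + 1)) * wVH d Lc j) := by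
  have hL : (Lc : ℝ) ^ (d + 1) ≠ 0 := pow_ne_zero _ (by exact_mod_cast NeZero.ne Lc)
  have hs : stepScale d Lc j ≠ 0 := stepScale_ne_zero j
  rw [wE_eq_stepScale_cube, wVH_eq_stepScale_sq]
  field_simp

/-- [folklore] **AT LEVEL `0`: `cE = (−2c₀)·cVH`, i.e. `w₀ = cE∕cVH = −2·Lc^{−(d+1)} = −2c₀`** (`stepScale 0 = wE 0 = wVH 0 = 1`) — Q-FP-19-1's «`w = −2c`» IS the
literal's level-0 Ward lock `cVH = −cE·cE′·Lc^{d+1}` (`WardLocusInduction.stepLocks_bcj_iff`, `cE′ = ½`) read per unit border insertion. -/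
theorem formWeight_zero :
    (Lc : ℝ) ^ (d + 1) = (-2 * ((Lc : ℝ) ^ (d + 1))⁻¹) * (-((Lc : ℝ) ^ (d + 1) * (1 / 2) * (Lc : ℝ) ^ (d + 1))) := by
  have hL : (Lc : ℝ) ^ (d + 1) ≠ 0 := pow_ne_zero _ (by exact_mod_cast NeZero.ne Lc)
  field_simp

omit [NeZero Lc] in
/-- [folklore] **THE REFLECTION-CONTACT GENERATOR WEIGHT IS TRANSPORT WEIGHT × BORDER-SLOT WEIGHT** (`d + 1 = 4`, the displayed `γ_j` of the (Sr-conj)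
letters, `CombLevelZeroT2Law` ∕ `CombSecondOrderRemainderAn1` `hγ`): `−(Lc⁸∕2)·wVH j∕(stepScale j·Lc⁴) = c_j · (−(Lc⁸∕2)·wVH j)` — the modulus of Q-FP-19-1's
identification (b) at every level. -/
theorem genWeight_eq (j : ℕ) :
    -((Lc : ℝ) ^ 8 / 2) * wVH 3 Lc j / (stepScale 3 Lc j * (Lc : ℝ) ^ 4) =
      (stepScale 3 Lc j * (Lc : ℝ) ^ (3 + 1))⁻¹ * (-((Lc : ℝ) ^ 8 / 2) * wVH 3 Lc j) := by
  rw [show (3 + 1 : ℕ) = 4 from rfl, div_eq_inv_mul]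

end Units

/-! ## §3 `d + 1 = 4`: the chart-(III′) literal `JsB12CombSh⁰`, and an1's closed record -/

section FourD

variable {Lc : ℕ} [NeZero Lc]

/-- [folklore] **(S₀) THE LITERAL's LEVEL-0 FIRST-ORDER MEMBER**: Wilson cubic sector `Lc⁴ • wilsonA`, border sector `−Lc⁸∕2 • tabs.V`, Λ-sector `cΛ`
(comb twin of `SymmetrisedStepJetsUnits.JsB12Sym0_S_zero`; the form slot at level `0` is `wilsonA`, whose gauge letter is leaf-05's `divV_wilsonA_inl_inl`). -/
theorem JsB12CombSh0_S_zero (hLc : Odd Lc) (N : ℕ) (tabs : SymTables 3 Lc) (cΛ cB : ℝ) :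
    (JsB12CombSh0 hLc N tabs cΛ cB 0).S = fun κ u =>
      ((Lc : ℝ) ^ 4) • wilsonA 3 κ u + (-((Lc : ℝ) ^ 8 / 2)) • tabs.V κ u
        + cΛ • SLam Lc (lamCoeffOf (KInv (N := Lc) (d := 3)) Lc) tabs.H κ u := by
  rw [JsB12CombSh0_eq, JsComb0Of_S, ScombOf_eq, SrecOf_zero]
  rfl

/-- [folklore] **(Sⱼ₊₁) THE LITERAL's LEVEL-`(j+1)` FIRST-ORDER MEMBER**: cubic (form-slot) sector `Lc⁴·wE (j+1)` through `e3OfK Lc (GcombSh Lc j)` of member `j`,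
border sector `−Lc⁸∕2·wVH (j+1)`, Λ-sector `cΛ·wΛ (j+1)` (comb twin of `SymmetrisedStepJetsUnits.JsB12Sym0_S_succ`). -/
theorem JsB12CombSh0_S_succ (hLc : Odd Lc) (N : ℕ) (tabs : SymTables 3 Lc) (cΛ cB : ℝ) (j : ℕ) :
    (JsB12CombSh0 hLc N tabs cΛ cB (j + 1)).S = fun κ u =>
      ((Lc : ℝ) ^ 4 * wE 3 Lc (j + 1)) • e3OfK Lc (GcombSh (d := 3) Lc j) (JsB12CombSh0 hLc N tabs cΛ cB j).S κ u
        + (-((Lc : ℝ) ^ 8 / 2) * wVH 3 Lc (j + 1)) • tabs.V κ u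
        + (cΛ * wΛ 3 Lc (j + 1)) • SLam Lc (lamCoeffK (KInvStep (d := 3) Lc (j + 1)) (E2 3 Lc (j + 1)) Lc) tabs.H κ u := by
  rw [JsB12CombSh0_eq, JsComb0Of_S, JsComb0Of_S, ScombOf_eq, SrecOf_succ]

/-- [folklore] **THE FORM SLOT OF THE CHART-(III′) LITERAL OBEYS THE PER-SITE GAUGE LETTER WITH CONSTANT `½` AT EVERY LEVEL `j+1 ≥ 1`**, under the (0.4)
border Ward law (S-V)⁰⁴ of `tabs.V` (traded for (V-d) by `DshAn1.hVd_iff`): `∀ j ρ′ u, divV (e3OfK Lc (GcombSh Lc j) (JsB12CombSh0 … j).S) u = ½ • conjV (E2 3 Lc (j+1)) (diagK (legInd ρ′ u))`. -/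
theorem divV_formSlot_JsB12CombSh0 (hLc : Odd Lc) (N : ℕ) (tabs : SymTables 3 Lc) (cΛ cB : ℝ)
    (hVd04 : ∀ u : Fin 4 → ℤ, divV tabs.V u = conjV (mfNeg (linSym04At (ctr 4 Lc) Lc)) (diagK (legInd (ctr 4 Lc) u))) :
    ∀ (j : ℕ) (ρ' u : Fin 4 → ℤ),
      divV (e3OfK Lc (GcombSh (d := 3) Lc j) (JsB12CombSh0 hLc N tabs cΛ cB j).S) u =
        (1 / 2 : ℝ) • conjV (E2 3 Lc (j + 1)) (diagK (legInd ρ' u)) := by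
  intro j ρ' u
  have hVd := (hVd_iff Lc (divV tabs.V)).2 hVd04
  have h := divV_e3OfK_SrecOf_GcombSh (d := 3) tabs.hV tabs.hH hVd cΛ j ρ' u
  have e : -((Lc : ℝ) ^ (3 + 1) * (1 / 2) * (Lc : ℝ) ^ (3 + 1)) = -((Lc : ℝ) ^ 8 / 2) := by ring
  rw [e] at h
  rw [JsB12CombSh0_eq, JsComb0Of_S, ScombOf_eq]
  exact h

/-- [folklore] **UNCONDITIONAL AT an1's CLOSED (0.4) RECORD `symTablesAn1S2 3 Lc cΛ`** (the tables of ROOT M″ ∕ M‴'s literal `JsB12CombShSym hLc N (symTablesAn1S2 3 Lc cΛ) cΛ cB`;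
(S-V)⁰⁴ = an1's `SymAveragingWardRootedStencils.divV_symVhSAt_eq_conjV_ctr`): for every level `j`, root `ρ′`, fine site `u`,
`divV (e3OfK Lc (GcombSh Lc j) (JsB12CombSh0 hLc N (symTablesAn1S2 3 Lc cΛ) cΛ cB j).S) u = ½ • conjV (E2 3 Lc (j+1)) (diagK (legInd ρ′ u))`.
HONEST: the stencil (infinite-lattice, per-site) gauge letter of the literal's form slot; the torus `k1` row is its periodisation (the road's); nothing of Bałaban's asserted; NOT D1. -/
theorem divV_formSlot_JsB12CombSh0_an1TablesS2 (hLc : Odd Lc) (N : ℕ) (cΛ cB : ℝ) :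
    ∀ (j : ℕ) (ρ' u : Fin 4 → ℤ),
      divV (e3OfK Lc (GcombSh (d := 3) Lc j) (JsB12CombSh0 hLc N (symTablesAn1S2 3 Lc cΛ) cΛ cB j).S) u =
        (1 / 2 : ℝ) • conjV (E2 3 Lc (j + 1)) (diagK (legInd ρ' u)) :=
  divV_formSlot_JsB12CombSh0 hLc N (symTablesAn1S2 3 Lc cΛ) cΛ cB (fun u => by
    rw [symTablesAn1S2_def]
    exact divV_symVhSAt_eq_conjV_ctr (d := 3) (one_le_of_neZero Lc) u)

/-- [folklore] **THE FIELD–FIELD BLOCK OF THE LITERAL's FORM-SLOT GAUGE LETTER, ENTRYWISE, EVERY LEVEL** (at an1's closed record; the input shape of the torus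
periodisation, cf. leaf-05's `divV_wilsonA_inl_inl` at level `0`): `(divV T_{j+1} u) x z (inl a) (inl b) = ½ · E2 3 Lc (j+1) x z (inl a) (inl b) · ([z = u] − [x = u])`. -/
theorem divV_formSlot_JsB12CombSh0_an1TablesS2_inl_inl (hLc : Odd Lc) (N : ℕ) (cΛ cB : ℝ) (j : ℕ) (u x z : Fin 4 → ℤ) (a b : Fin 4) :
    divV (e3OfK Lc (GcombSh (d := 3) Lc j) (JsB12CombSh0 hLc N (symTablesAn1S2 3 Lc cΛ) cΛ cB j).S) u x z (Sum.inl a) (Sum.inl b) =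
      (1 / 2 : ℝ) * (E2 3 Lc (j + 1) x z (Sum.inl a) (Sum.inl b) * ((if z = u then 1 else 0) - (if x = u then 1 else 0))) := by
  have h := congrFun (congrFun (congrFun (congrFun (divV_formSlot_JsB12CombSh0_an1TablesS2 hLc N cΛ cB j u u) x) z) (Sum.inl a)) (Sum.inl b)
  rw [h, Pi.smul_apply, Pi.smul_apply, Pi.smul_apply, Pi.smul_apply, smul_eq_mul, conjV_diagK_apply, legInd_inl, legInd_inl]

end FourD

end Summit.QuantumFields.BalabanUV.Beta.CombFormSlotGaugeLetter

end
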